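import Summits.RiemannHypothesis.RiemannHypothesis.Theorems.SuzukiStructureFunctionsPhiSystem
import Mathlib.MeasureTheory.Integral.IntervalIntegral.FundThmCalculus
import Mathlib.MeasureTheory.Integral.Bochner.ContinuousLinearMap
import HarnessLib

/-!
# SuzukiStructureFunctionsWindowFunctional — window functionals `t ↦ ∫_{(−t,t)} g(y)φ^ε(t,y)dy` are differentiable
# for `K ∈ C¹`: derivative `g(t)φ^ε(t,t) + ∫_{(−t,t)} g ∂_tφ^ε` (real and complex test functions), via the
# `L²(ℝ)`-continuous resolvent slope family (column DBR; RH-FREE)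

LINE 1 — LABEL: RH-FREE (Fredholm/resolvent analysis on `L²(ℝ)` + FTC, ANY `C¹` kernel vanishing on `(−∞,0]`; no `ζ`,
no zeros, no positivity); bears_on LADDER-RH B-D → B-P(P1)/(P3): this is the differentiation-under-the-window-integral
step of Prop. 3.2 / Thm. 3.1 (4) (Suzuki JFA21 §3.6), done WITHOUT uniform bounds on `∂_tφ^ε`: the slope of the window
term is the inner product of `𝟙_{[−s,s]}g` with `V_s = (1+ε𝖪[s])⁻¹𝟙G(s,·)`, continuous in `s` (…WindowResolvent),
and `V_t = 𝟙ψ` for the `L²` solution `ψ = ∂_tφ^ε(t,·)` of (3.20) (…PhiSystem).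
WHAT THIS IS NOT: not progress toward RH; the canonical system (Thm. 3.1 (4)) is NOT proved in this file.

Source: M. Suzuki, J. Funct. Anal. 281 (2021) 109116 = arXiv:1606.05726 [Suzuki2021Hamiltonians], §3.4–§3.6
(Lemma 3.6, (3.20), Prop. 3.2).

Contents (seat rh-dbr-eng-5 g7): `inner_toLp_indicator_window_eq`, **`exists_resolvent_slope_family`**,
**`hasDerivAt_window_functional`** (real `g`), `setIntegral_mul_ofReal_eq`, **`hasDerivAt_window_functional_complex`**.
-/

noncomputable section

-- D-0017: `Summit.<S>.<S>.…` is the designed namespace of a single-problem summit.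
set_option linter.dupNamespace false

open MeasureTheory Set Filter Topology Function
open scoped ENNReal RealInnerProductSpace

namespace Summit.RiemannHypothesis.RiemannHypothesis.Theorems.SuzukiStructureFunctions

open Literature.Analysis.OperatorTheory Literature.NumberTheory.LFunctions
  Literature.NumberTheory.LFunctions.SuzukiStructure
open Summit.RiemannHypothesis.RiemannHypothesis.Theorems.SuzukiPhiExistence
  (continuous_suzukiPhiExt setIntegral_Iic_kernel_mul_suzukiPhiExt_eq exists_isSuzukiPhiSolution_of_noUnitEigenvalue)

variable {K : ℝ → ℝ} {ε t : ℝ}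

/-! ## §27 Window functionals are differentiable in `t`: for `K ∈ C¹` and continuous `g`,
`(d/dt)∫_{(−t,t)} g(y)φ^ε(t,y)dy = g(t)φ^ε(t,t) + ∫_{(−t,t)} g(y)∂_tφ^ε(t,y)dy` — by the `L²(ℝ)`-continuity of the
resolvent slope family `V_s = (1+ε𝖪[s])⁻¹𝟙G(s,·)` (no uniform bounds on `∂_tφ` are needed) -/

/-- RH-FREE. `⟪𝟙_{[−s,s]}g, v⟫ = ∫_{(−s,s)} g f` whenever `v = 𝟙_{[−s,s]}f` a.e. (`g` continuous). -/
theorem inner_toLp_indicator_window_eq {g : ℝ → ℝ} (hg : Continuous (uncurry fun _ y : ℝ => g y)) (s : ℝ)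
    (v : Lp ℝ 2 (volume : Measure ℝ)) (f : ℝ → ℝ)
    (hv : (v : ℝ → ℝ) =ᵐ[volume] fun y => (Icc (-s) s).indicator f y) :
    ⟪(memLp_indicator_window hg s).toLp _, v⟫ = ∫ y in Ioo (-s) s, g y * f y := by
  have hgm : MemLp (fun y : ℝ => (Icc (-s) s).indicator (fun y => g y) y) 2 (volume : Measure ℝ) :=
    memLp_indicator_window hg s
  rw [← integral_l2Kernel_mul_eq_inner (K := fun _ y : ℝ => (Icc (-s) s).indicator (fun y => g y) y) (x := s) hgm v]
  rw [← setIntegral_congr_set (Ioo_ae_eq_Icc (μ := (volume : Measure ℝ))).symm,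
    ← integral_indicator measurableSet_Icc]
  refine integral_congr_ae ?_
  filter_upwards [hv] with y hy
  rw [hy]
  by_cases hyI : y ∈ Icc (-s) s
  · rw [indicator_of_mem hyI, indicator_of_mem hyI, indicator_of_mem hyI]
  · rw [indicator_of_notMem hyI, indicator_of_notMem hyI, zero_mul, indicator_of_notMem hyI]

/-- **RH-FREE · THE RESOLVENT SLOPE FAMILY.** At a clean window `t ≥ 0` (`K ∈ C¹` vanishing on `(−∞,0]`) there is an
`L²(ℝ)`-valued family `V_s` (namely `(1+ε𝖪[s])⁻¹(𝟙_{[−s,s]}G(s,·))`, `G` from …PhiTimeDerivative) with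
(a) `s ↦ V_s` continuous at `t` within the clean windows, (b) `(s−t)V_s = 𝟙_{[−s,s]}(φ^ε(s,·) − φ^ε(t,·))` a.e. for
every clean `s ≥ 0`, (c) `V_t = 𝟙_{(−t,t)}ψ` a.e. for EVERY `ψ ∈ L²(−t,t)` solving (3.20) — in particular for
`ψ = ∂_tφ^ε(t,·)` (…PhiSystem). -/
theorem exists_resolvent_slope_family (hKd : ContDiff ℝ 1 K) (hK0 : ∀ u : ℝ, u ≤ 0 → K u = 0) (hε : ε = 1 ∨ ε = -1)
    (ht0 : 0 ≤ t) (hN : NoUnitEigenvalue K t) :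
    ∃ V : ℝ → Lp ℝ 2 (volume : Measure ℝ),
      ContinuousWithinAt V {s : ℝ | 0 ≤ s ∧ NoUnitEigenvalue K s} t ∧
      (∀ s : ℝ, 0 ≤ s → NoUnitEigenvalue K s →
        ((((s - t) • V s : Lp ℝ 2 (volume : Measure ℝ)) : ℝ → ℝ) =ᵐ[volume]
          fun y => (Icc (-s) s).indicator (fun y => suzukiPhiExt K ε s y - suzukiPhiExt K ε t y) y)) ∧
      (∀ ψ : ℝ → ℝ, MemLp ψ 2 (volume.restrict (Ioo (-t) t)) →
        (∀ x : ℝ, ψ x + ε * ∫ y in Ioo (-t) t, K (x + y) * ψ y =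
          deriv K (x + t) - ε * suzukiPhiExt K ε t t * K (x + t)) →
        ((V t : Lp ℝ 2 (volume : Measure ℝ)) : ℝ → ℝ) =ᵐ[volume] (Ioo (-t) t).indicator ψ) := by
  have hKc : Continuous K := hKd.continuous
  have hK3 : ∀ u : ℝ, u < 0 → K u = 0 := fun u hu => hK0 u hu.le
  have hsol_t : ∃ X, IsSuzukiPhiSolution K ε t X := exists_isSuzukiPhiSolution_of_noUnitEigenvalue hKc hK0 hε hN
  obtain ⟨G, hGdef⟩ : ∃ G : ℝ → ℝ → ℝ, G = fun s y : ℝ => ∫ θ in (0:ℝ)..1, (deriv K (y + t + θ * (s - t)) -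
      ε * (K (y + (t + θ * (s - t))) * suzukiPhiExt K ε t (t + θ * (s - t)) +
        K (y + (-t - θ * (s - t))) * suzukiPhiExt K ε t (-t - θ * (s - t)))) := ⟨_, rfl⟩
  have hGc : Continuous (uncurry G) := by rw [hGdef]; exact continuous_uncurry_diffQuotKernel hKd hK0 ε t
  have hUapply : ∀ (s : ℝ) (v : Lp ℝ 2 (volume : Measure ℝ)),
      (((1 + ε • winOpL2 K hKc s) v : Lp ℝ 2 (volume : Measure ℝ)) : ℝ → ℝ) =ᵐ[volume]
        fun x => v x + ε * ∫ y, winKer K s x y * (v : ℝ → ℝ) y := by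
    intro s v
    have e : (1 + ε • winOpL2 K hKc s) v = v + ε • winOpL2 K hKc s v := by simp
    rw [e]
    filter_upwards [Lp.coeFn_add v (ε • winOpL2 K hKc s v), Lp.coeFn_smul ε (winOpL2 K hKc s v),
      winOpL2_spec hKc s v] with x hx1 hx2 hx3
    rw [hx1, Pi.add_apply, hx2, Pi.smul_apply, smul_eq_mul, hx3]
  have hGt : ∀ x : ℝ, G t x = deriv K (x + t) - ε * suzukiPhiExt K ε t t * K (x + t) := by
    intro x
    rw [hGdef]
    simp only [sub_self, mul_zero, add_zero, sub_zero, intervalIntegral.integral_const, one_smul,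
      suzukiPhiExt_neg_self hK0 hsol_t]
    ring
  have hpts : ∀ᵐ x ∂(volume : Measure ℝ), x ≠ -t ∧ x ≠ t := by
    have e1 : ({-t}ᶜ : Set ℝ) ∈ ae (volume : Measure ℝ) := compl_mem_ae_iff.mpr (measure_singleton _)
    have e2 : ({t}ᶜ : Set ℝ) ∈ ae (volume : Measure ℝ) := compl_mem_ae_iff.mpr (measure_singleton _)
    filter_upwards [e1, e2] with x hx1 hx2
    exact ⟨hx1, hx2⟩
  refine ⟨fun s => Ring.inverse (1 + ε • winOpL2 K hKc s) ((memLp_indicator_window hGc s).toLp _), ?_, ?_, ?_⟩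
  · -- (a) continuity
    exact ((continuousWithinAt_inverse_winOpL2 hKc hε ht0 hN).clm_apply
      ((continuousOn_toLp_indicator_window hGc) t ht0)).mono fun s hs => hs.1
  · -- (b) the difference identity in `L²(ℝ)`
    intro s hs0 hNs
    have hsol_s : ∃ X, IsSuzukiPhiSolution K ε s X := exists_isSuzukiPhiSolution_of_noUnitEigenvalue hKc hK0 hε hNs
    set U : Lp ℝ 2 (volume : Measure ℝ) →L[ℝ] Lp ℝ 2 (volume : Measure ℝ) := 1 + ε • winOpL2 K hKc s with hU
    have hUu : IsUnit U := isUnit_one_add_smul_winOpL2 hKc hε hNs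
    have hDc : Continuous (uncurry fun _ y : ℝ => suzukiPhiExt K ε s y - suzukiPhiExt K ε t y) :=
      ((continuous_suzukiPhiExt hKc hK3 ε s).sub (continuous_suzukiPhiExt hKc hK3 ε t)).comp continuous_snd
    set d : Lp ℝ 2 (volume : Measure ℝ) := (memLp_indicator_window hDc s).toLp _ with hd
    set q : Lp ℝ 2 (volume : Measure ℝ) := (memLp_indicator_window hGc s).toLp _ with hq
    have hd_ae : (d : ℝ → ℝ) =ᵐ[volume]
        fun y => (Icc (-s) s).indicator (fun y => suzukiPhiExt K ε s y - suzukiPhiExt K ε t y) y :=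
      MemLp.coeFn_toLp _
    have hq_ae : (q : ℝ → ℝ) =ᵐ[volume] fun y => (Icc (-s) s).indicator (fun y => G s y) y := MemLp.coeFn_toLp _
    have hDeq : ∀ x : ℝ, (suzukiPhiExt K ε s x - suzukiPhiExt K ε t x) +
        ε * ∫ y in Ioo (-s) s, K (x + y) * (suzukiPhiExt K ε s y - suzukiPhiExt K ε t y) = (s - t) * G s x := by
      intro x; rw [hGdef]; exact suzukiPhiExt_sub_eq hKd hK0 hsol_s hsol_t hs0 ht0 x
    have hUd : U d = (s - t) • q := by
      apply Lp.ext
      filter_upwards [hUapply s d, hd_ae, Lp.coeFn_smul (s - t) q, hq_ae] with x e1 e3 e4 e5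
      rw [e1, e4, Pi.smul_apply, smul_eq_mul, e5]
      have hint : ∫ y, winKer K s x y * (d : ℝ → ℝ) y =
          ∫ y, winKer K s x y * (Icc (-s) s).indicator (fun y => suzukiPhiExt K ε s y - suzukiPhiExt K ε t y) y :=
        integral_congr_ae (by filter_upwards [hd_ae] with y hy; rw [hy])
      rw [hint]
      by_cases hx : x ∈ Icc (-s) s
      · rw [e3, indicator_of_mem hx, indicator_of_mem hx, integral_winKer_mul_eq_setIntegral K hx]
        have hIoo : ∫ y in Ioo (-s) s, K (x + y) *
            (Icc (-s) s).indicator (fun y => suzukiPhiExt K ε s y - suzukiPhiExt K ε t y) y =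
            ∫ y in Ioo (-s) s, K (x + y) * (suzukiPhiExt K ε s y - suzukiPhiExt K ε t y) :=
          setIntegral_congr_fun measurableSet_Ioo fun y hy => by rw [indicator_of_mem (Ioo_subset_Icc_self hy)]
        rw [hIoo]
        exact hDeq x
      · rw [e3, indicator_of_notMem hx, indicator_of_notMem hx, integral_winKer_mul_eq_zero K hx]
        ring
    have hdR : d = (s - t) • Ring.inverse U q := by
      calc d = (Ring.inverse U * U) d := by rw [Ring.inverse_mul_cancel U hUu]; rfl
        _ = Ring.inverse U (U d) := rfl
        _ = (s - t) • Ring.inverse U q := by rw [hUd, map_smul]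
    have e : ((s - t) • Ring.inverse U q : Lp ℝ 2 (volume : Measure ℝ)) =
        (s - t) • Ring.inverse (1 + ε • winOpL2 K hKc s) ((memLp_indicator_window hGc s).toLp _) := rfl
    rw [← e, ← hdR]
    exact hd_ae
  · -- (c) identification at `s = t` by uniqueness
    intro ψ hψmem hψeq
    set U : Lp ℝ 2 (volume : Measure ℝ) →L[ℝ] Lp ℝ 2 (volume : Measure ℝ) := 1 + ε • winOpL2 K hKc t with hU
    have hUu : IsUnit U := isUnit_one_add_smul_winOpL2 hKc hε hN
    set q : Lp ℝ 2 (volume : Measure ℝ) := (memLp_indicator_window hGc t).toLp _ with hq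
    have hq_ae : (q : ℝ → ℝ) =ᵐ[volume] fun y => (Icc (-t) t).indicator (fun y => G t y) y := MemLp.coeFn_toLp _
    have hfI : MemLp ((Ioo (-t) t).indicator ψ) 2 (volume : Measure ℝ) :=
      (memLp_indicator_iff_restrict measurableSet_Ioo).2 hψmem
    set v : Lp ℝ 2 (volume : Measure ℝ) := hfI.toLp _ with hv
    have hv_ae : (v : ℝ → ℝ) =ᵐ[volume] (Ioo (-t) t).indicator ψ := MemLp.coeFn_toLp _
    have hUv : U v = q := by
      apply Lp.ext
      filter_upwards [hUapply t v, hv_ae, hq_ae, hpts] with x e1 e2 e3 e4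
      rw [e1, e2, e3]
      have hint : ∫ y, winKer K t x y * (v : ℝ → ℝ) y = ∫ y, winKer K t x y * (Ioo (-t) t).indicator ψ y :=
        integral_congr_ae (by filter_upwards [hv_ae] with y hy; rw [hy])
      rw [hint]
      by_cases hx : x ∈ Ioo (-t) t
      · rw [indicator_of_mem hx, indicator_of_mem (Ioo_subset_Icc_self hx),
          integral_winKer_mul_eq_setIntegral K (Ioo_subset_Icc_self hx)]
        have hIoo : ∫ y in Ioo (-t) t, K (x + y) * (Ioo (-t) t).indicator ψ y = ∫ y in Ioo (-t) t, K (x + y) * ψ y :=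
          setIntegral_congr_fun measurableSet_Ioo fun y hy => by rw [indicator_of_mem hy]
        rw [hIoo, hψeq x, hGt x]
      · have hxI : x ∉ Icc (-t) t := fun h' => hx ⟨lt_of_le_of_ne h'.1 (Ne.symm e4.1), lt_of_le_of_ne h'.2 e4.2⟩
        rw [indicator_of_notMem hx, indicator_of_notMem hxI, integral_winKer_mul_eq_zero K hxI]
        ring
    have hvR : v = Ring.inverse U q := by
      calc v = (Ring.inverse U * U) v := by rw [Ring.inverse_mul_cancel U hUu]; rfl
        _ = Ring.inverse U (U v) := rfl
        _ = Ring.inverse U q := by rw [hUv]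
    show (((Ring.inverse (1 + ε • winOpL2 K hKc t)) ((memLp_indicator_window hGc t).toLp _) :
      Lp ℝ 2 (volume : Measure ℝ)) : ℝ → ℝ) =ᵐ[volume] (Ioo (-t) t).indicator ψ
    have e : (Ring.inverse U q : Lp ℝ 2 (volume : Measure ℝ)) =
        Ring.inverse (1 + ε • winOpL2 K hKc t) ((memLp_indicator_window hGc t).toLp _) := rfl
    rw [← e, ← hvR]
    exact hv_ae

/-- **RH-FREE · WINDOW FUNCTIONALS ARE DIFFERENTIABLE IN `t` (real test functions):** for `K ∈ C¹` vanishing on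
`(−∞,0]`, a clean range `[0,τ)`, `t ∈ (0,τ)` and a continuous `g : ℝ → ℝ`,
`(d/dt)∫_{(−t,t)} g(y)φ^ε(t,y)dy = g(t)φ^ε(t,t) + ∫_{(−t,t)} g(y)∂_tφ^ε(t,y)dy` (`φ^ε(t,−t) = 0`; the slope of the
window term is `⟪𝟙g, V_s⟫` with the `L²`-continuous resolvent slope family, the moving endpoints by FTC). -/
theorem hasDerivAt_window_functional (hKd : ContDiff ℝ 1 K) (hK0 : ∀ u : ℝ, u ≤ 0 → K u = 0) (hε : ε = 1 ∨ ε = -1)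
    {τ : ℝ} (hclean : ∀ s : ℝ, s ∈ Ico 0 τ → NoUnitEigenvalue K s) (ht : t ∈ Ioo 0 τ) {g : ℝ → ℝ}
    (hg : Continuous g) :
    HasDerivAt (fun s : ℝ => ∫ y in Ioo (-s) s, g y * suzukiPhiExt K ε s y)
      (g t * suzukiPhiExt K ε t t + ∫ y in Ioo (-t) t, g y * deriv (fun s : ℝ => suzukiPhiExt K ε s y) t) t := by
  have ht0 : 0 ≤ t := ht.1.le
  have hN : NoUnitEigenvalue K t := hclean t ⟨ht0, ht.2⟩
  have hKc : Continuous K := hKd.continuous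
  have hK3 : ∀ u : ℝ, u < 0 → K u = 0 := fun u hu => hK0 u hu.le
  have hsol_t : ∃ X, IsSuzukiPhiSolution K ε t X := exists_isSuzukiPhiSolution_of_noUnitEigenvalue hKc hK0 hε hN
  obtain ⟨ψ, hψmem, hψeq, hψd⟩ := hasDerivAt_suzukiPhiExt_memLp hKd hK0 hε hclean ht
  have eI : ∫ y in Ioo (-t) t, g y * deriv (fun s : ℝ => suzukiPhiExt K ε s y) t = ∫ y in Ioo (-t) t, g y * ψ y := by
    refine setIntegral_congr_fun measurableSet_Ioo fun y _ => ?_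
    rw [(hψd y).deriv]
  rw [eI]
  obtain ⟨V, hVc, hVb, hVt⟩ := exists_resolvent_slope_family (ε := ε) hKd hK0 hε ht0 hN
  have hVψ : ((V t : Lp ℝ 2 (volume : Measure ℝ)) : ℝ → ℝ) =ᵐ[volume] fun y => (Icc (-t) t).indicator ψ y :=
    (hVt ψ hψmem hψeq).trans (indicator_ae_eq_of_ae_eq_set (Ioo_ae_eq_Icc (μ := (volume : Measure ℝ))))
  have hgc : Continuous (uncurry fun _ y : ℝ => g y) := hg.comp continuous_snd
  set φt := suzukiPhiExt K ε t with hφt_def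
  have hφt : Continuous φt := continuous_suzukiPhiExt hKc hK3 ε t
  -- the moving-window part `J(s) = ∫_{(−s,s)} gφ_t`
  have hf : Continuous fun y : ℝ => g y * φt y := hg.mul hφt
  have hF : ∀ u : ℝ, HasDerivAt (fun u : ℝ => ∫ y in (0:ℝ)..u, g y * φt y) (g u * φt u) u :=
    fun u => (hf.integral_hasStrictDerivAt 0 u).hasDerivAt
  have hJ : HasDerivAt (fun s : ℝ => ∫ y in Ioo (-s) s, g y * φt y) (g t * φt t) t := by
    have h1 : HasDerivAt (fun s : ℝ => (∫ y in (0:ℝ)..s, g y * φt y) - ∫ y in (0:ℝ)..(-s), g y * φt y)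
        (g t * φt t - g (-t) * φt (-t) * (-1)) t :=
      (hF t).sub ((hF (-t)).comp t (hasDerivAt_neg t))
    rw [hφt_def, suzukiPhiExt_neg_self hK0 hsol_t] at h1
    simp only [mul_zero, zero_mul, sub_zero] at h1
    refine h1.congr_of_eventuallyEq ?_
    filter_upwards [Ioi_mem_nhds ht.1] with s hs
    rw [setIntegral_Ioo_eq_intervalIntegral (le_of_lt hs),
      intervalIntegral.integral_interval_sub_left (hf.intervalIntegrable _ _) (hf.intervalIntegrable _ _)]
  -- the slope identity
  have hslope : ∀ s : ℝ, s ∈ Ioo 0 τ → s ≠ t →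
      slope (fun s : ℝ => ∫ y in Ioo (-s) s, g y * suzukiPhiExt K ε s y) t s =
        ⟪(memLp_indicator_window hgc s).toLp _, V s⟫ + slope (fun s : ℝ => ∫ y in Ioo (-s) s, g y * φt y) t s := by
    intro s hs hne
    have hNs : NoUnitEigenvalue K s := hclean s ⟨hs.1.le, hs.2⟩
    have hne' : s - t ≠ 0 := sub_ne_zero.2 hne
    have hφs : Continuous (suzukiPhiExt K ε s) := continuous_suzukiPhiExt hKc hK3 ε s
    -- `∫ g(φ_s − φ_t) = (s−t)⟪𝟙g, V_s⟫`
    have hin : ⟪(memLp_indicator_window hgc s).toLp _, (s - t) • V s⟫ =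
        ∫ y in Ioo (-s) s, g y * (suzukiPhiExt K ε s y - φt y) :=
      inner_toLp_indicator_window_eq hgc s ((s - t) • V s) _ (hVb s hs.1.le hNs)
    rw [real_inner_smul_right] at hin
    have hsplit : ∫ y in Ioo (-s) s, g y * suzukiPhiExt K ε s y =
        (∫ y in Ioo (-s) s, g y * (suzukiPhiExt K ε s y - φt y)) + ∫ y in Ioo (-s) s, g y * φt y := by
      rw [← integral_add]
      · refine setIntegral_congr_fun measurableSet_Ioo fun y _ => by ring
      · exact ((hg.mul (hφs.sub hφt)).integrableOn_Icc).mono_set Ioo_subset_Icc_self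
      · exact (hf.integrableOn_Icc).mono_set Ioo_subset_Icc_self
    rw [slope_def_field, slope_def_field, hsplit, ← hin]
    field_simp
    ring
  -- limits
  rw [hasDerivAt_iff_tendsto_slope]
  have hS : {s : ℝ | 0 ≤ s ∧ NoUnitEigenvalue K s} ∈ 𝓝 t := by
    filter_upwards [Ioo_mem_nhds ht.1 ht.2] with s hs
    exact ⟨hs.1.le, hclean s ⟨hs.1.le, hs.2⟩⟩
  have h1 : ContinuousWithinAt (fun s : ℝ => ⟪(memLp_indicator_window hgc s).toLp _, V s⟫)
      {s : ℝ | 0 ≤ s ∧ NoUnitEigenvalue K s} t :=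
    (((continuousOn_toLp_indicator_window hgc) t ht0).mono fun s hs => hs.1).inner hVc
  have h1' : Tendsto (fun s : ℝ => ⟪(memLp_indicator_window hgc s).toLp _, V s⟫) (𝓝[≠] t)
      (𝓝 (∫ y in Ioo (-t) t, g y * ψ y)) := by
    have h := (h1.continuousAt hS).tendsto.mono_left (nhdsWithin_le_nhds (s := ({t}ᶜ : Set ℝ)))
    rwa [inner_toLp_indicator_window_eq hgc t (V t) ψ hVψ] at h
  have h2 : Tendsto (slope (fun s : ℝ => ∫ y in Ioo (-s) s, g y * φt y) t) (𝓝[≠] t) (𝓝 (g t * φt t)) :=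
    hasDerivAt_iff_tendsto_slope.1 hJ
  have h3 := h1'.add h2
  rw [show g t * φt t + ∫ y in Ioo (-t) t, g y * ψ y = (∫ y in Ioo (-t) t, g y * ψ y) + g t * φt t by ring]
  refine h3.congr' ?_
  have hev : ∀ᶠ s in 𝓝[≠] t, s ∈ Ioo 0 τ := mem_nhdsWithin_of_mem_nhds (Ioo_mem_nhds ht.1 ht.2)
  filter_upwards [hev, self_mem_nhdsWithin] with s hs hne
  exact (hslope s hs hne).symm

/-- RH-FREE. Window integrals of a complex continuous `g` against a real `h` split into real and imaginary parts. -/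
theorem setIntegral_mul_ofReal_eq (g : ℝ → ℂ) {h : ℝ → ℝ} {a b : ℝ}
    (hgh : IntegrableOn (fun y => g y * (h y : ℂ)) (Ioo a b)) :
    ∫ y in Ioo a b, g y * (h y : ℂ) =
      ((∫ y in Ioo a b, (g y).re * h y : ℝ) : ℂ) + ((∫ y in Ioo a b, (g y).im * h y : ℝ) : ℂ) * Complex.I := by
  rw [← integral_re_add_im hgh]
  have e1 : (∫ y in Ioo a b, RCLike.re (g y * (h y : ℂ))) = ∫ y in Ioo a b, (g y).re * h y := by
    refine integral_congr_ae (Eventually.of_forall fun y => ?_)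
    simp only [RCLike.re_to_complex, Complex.mul_re, Complex.ofReal_re, Complex.ofReal_im, mul_zero, sub_zero]
  have e2 : (∫ y in Ioo a b, RCLike.im (g y * (h y : ℂ))) = ∫ y in Ioo a b, (g y).im * h y := by
    refine integral_congr_ae (Eventually.of_forall fun y => ?_)
    simp only [RCLike.im_to_complex, Complex.mul_im, Complex.ofReal_re, Complex.ofReal_im, mul_zero, zero_add]
  rw [e1, e2, RCLike.I_to_complex]
  rfl

/-- **RH-FREE · WINDOW FUNCTIONALS ARE DIFFERENTIABLE IN `t` (complex test functions):** as
`hasDerivAt_window_functional`, for continuous `g : ℝ → ℂ` (e.g. `g(y) = E(z)e^{izy} ± E(−z)e^{−izy}`):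
`(d/dt)∫_{(−t,t)} g(y)φ^ε(t,y)dy = g(t)φ^ε(t,t) + ∫_{(−t,t)} g(y)∂_tφ^ε(t,y)dy`. -/
theorem hasDerivAt_window_functional_complex (hKd : ContDiff ℝ 1 K) (hK0 : ∀ u : ℝ, u ≤ 0 → K u = 0)
    (hε : ε = 1 ∨ ε = -1) {τ : ℝ} (hclean : ∀ s : ℝ, s ∈ Ico 0 τ → NoUnitEigenvalue K s) (ht : t ∈ Ioo 0 τ)
    {g : ℝ → ℂ} (hg : Continuous g) :
    HasDerivAt (fun s : ℝ => ∫ y in Ioo (-s) s, g y * (suzukiPhiExt K ε s y : ℂ))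
      (g t * suzukiPhiExt K ε t t +
        ∫ y in Ioo (-t) t, g y * ((deriv (fun s : ℝ => suzukiPhiExt K ε s y) t : ℝ) : ℂ)) t := by
  have ht0 : 0 ≤ t := ht.1.le
  have hKc : Continuous K := hKd.continuous
  have hK3 : ∀ u : ℝ, u < 0 → K u = 0 := fun u hu => hK0 u hu.le
  have hg1 : Continuous fun y : ℝ => (g y).re := Complex.continuous_re.comp hg
  have hg2 : Continuous fun y : ℝ => (g y).im := Complex.continuous_im.comp hg
  have h1 := hasDerivAt_window_functional hKd hK0 hε hclean ht hg1
  have h2 := hasDerivAt_window_functional hKd hK0 hε hclean ht hg2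
  obtain ⟨ψ, hψmem, hψeq, hψd⟩ := hasDerivAt_suzukiPhiExt_memLp hKd hK0 hε hclean ht
  haveI : IsFiniteMeasure (volume.restrict (Ioo (-t) t)) :=
    ⟨by rw [Measure.restrict_apply_univ]; exact measure_Ioo_lt_top⟩
  have hψint : IntegrableOn ψ (Ioo (-t) t) := hψmem.integrable one_le_two
  -- bounded `g` on the window times integrable
  have hgψ : IntegrableOn (fun y : ℝ => g y * (ψ y : ℂ)) (Ioo (-t) t) := by
    obtain ⟨C, hC⟩ : ∃ C, ∀ u ∈ Icc (-t) t, ‖g u‖ ≤ C := isCompact_Icc.exists_bound_of_continuousOn hg.continuousOn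
    refine (hψint.ofReal (𝕜 := ℂ)).bdd_mul (c := C) hg.aestronglyMeasurable ?_
    rw [ae_restrict_iff' measurableSet_Ioo]
    exact Eventually.of_forall fun y hy => hC y (Ioo_subset_Icc_self hy)
  have hgφ : ∀ s : ℝ, IntegrableOn (fun y : ℝ => g y * (suzukiPhiExt K ε s y : ℂ)) (Ioo (-s) s) := fun s =>
    ((hg.mul (Complex.continuous_ofReal.comp (continuous_suzukiPhiExt hKc hK3 ε s))).integrableOn_Icc).mono_set
      Ioo_subset_Icc_self
  -- assemble real and imaginary parts
  have h12 := (h1.ofReal_comp).add ((h2.ofReal_comp).mul_const Complex.I)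
  have ederiv : ∀ y : ℝ, deriv (fun s : ℝ => suzukiPhiExt K ε s y) t = ψ y := fun y => (hψd y).deriv
  simp only [ederiv] at h12 ⊢
  have efun : (fun s : ℝ => ∫ y in Ioo (-s) s, g y * (suzukiPhiExt K ε s y : ℂ)) =
      fun s : ℝ => ((∫ y in Ioo (-s) s, (g y).re * suzukiPhiExt K ε s y : ℝ) : ℂ) +
        ((∫ y in Ioo (-s) s, (g y).im * suzukiPhiExt K ε s y : ℝ) : ℂ) * Complex.I := by
    funext s
    exact setIntegral_mul_ofReal_eq g (hgφ s)
  rw [efun]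
  refine h12.congr_deriv ?_
  rw [setIntegral_mul_ofReal_eq g hgψ]
  apply Complex.ext
  · simp [Complex.mul_re]
  · simp [Complex.mul_im]

end Summit.RiemannHypothesis.RiemannHypothesis.Theorems.SuzukiStructureFunctions
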